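import Summits.QuantumFields.YangMills.Theorems.UnitScaleTiltProp7FirstVariationMultiplierBound
import Summits.QuantumFields.YangMills.Theorems.UnitScaleTiltProp7FirstVariationWeakEL
import HarnessLib

/-!
# Route `UnitScaleTilt`, crux K1 «MinimiserStabilityRegPr» (stmt-QuantumFields-19200), route-R row (δ′) FILE 2b (★★OWNER g27 ACK 58 (2) ∕ ACK 62 (3), 2026-08-28) —
# THE BOUNDED MULTIPLIER AND ITS RIESZ FIELD AT A STATIONARY FIBRE POINT: the `Q`-currency bound `|Lin_W(A)| ≤ 2ε₀ℓ⁻¹·Σ_c‖(Q (K−n) A)(c)‖`, the exact pairing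
# `Lin_W = Λ ∘ Q (K−n)` with `|Λ Z| ≤ 2ε₀ℓ⁻¹‖Z‖₁`, `Λ ⊥` coarse pure gauges, and `‖λ(c)‖ ≤ 2ε₀ℓ⁻¹` — under the WEAK E–L LETTER instead of `IsCritR2`

Cell `ym3-torus`, keyed width hand `ym-routeR-w2` (gen 2).  THEOREMS ONLY (0 `def`, 0 `sorry`); `--supports stmt-QuantumFields-19200`, count-neutral.  YM₃ on T³ is a ladder
rung (R3), not the Clay problem; nothing here claims a stub, the crux, d = 4 or the mass gap.

WHY.  FILE 1 (`Prop7FirstVariationMultiplierBound`, ✓p635612) and (R-δ) FILE 2 (`Prop7FirstVariationExactPairing`, ✓p633748) are stated at an R2-critical `U₀`; the EX knit's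
`W` and the α-P JOINT-ROW door carry only the stationarity clause `hEL`.  FILE 2a (`Prop7FirstVariationWeakEL`) displays the WEAK E–L LETTER `hELw` — `Lin_W(ξ) = 0` along
every bondwise-differentiable curve through `W` lying in `𝔅_k(V)` near `0` — proves it from `hEL` and from `IsCritR2`, and re-runs w1's multiplier bound under it.  This file
carries the rest of the chain to `hELw`: the `Q`-currency bound (the (R-δ) bridge `Prop7TrueLinIterHasDeriv.hasDerivAt_iter` along `s ↦ e^{sA}W`), the Hahn–Banach
multiplier with its `ℓ¹`-dual size, and the Riesz field with its pointwise size — so that the door at a STATIONARY `W ∈ 𝔅_k(V) ∩ (6)(ε₀)` may read the multiplier form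
`|Lin_W(A)| = |⟨λ, Q_W A⟩| ≤ 2ε₀ℓ⁻¹‖Q_W A‖₁` (★p1 g13 12:50:48Z (c)) with NO minimality input.  §3 spells the two instances (EX knit's `hEL`; `IsCritR2`).

WHAT IS PROVED (ns `…Theorems.Prop7FirstVariationMultiplierBoundWeakEL`; T³, SU(2); binders `hnK`, `hWfib : W ∈ 𝔅_k(V)`, `hELw`, `hε₀`, `10¹⁰L⁶ε₀ ≤ 1`, `RegPr ε₀ W`,
recursion family `Q hQ0 hQs` as in ✓p633748).
* §1 ★★ `abs_lin_le_sum_norm_trueLinIter_weakEL` — `|Lin_W(A)| ≤ 2ε₀(L^{K−n})⁻¹·Σ_c‖Q (K−n) A c‖` for every `𝔰𝔲(2)`-valued `A`.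
* §2 ★★ `exists_multiplier_functional_bounded_weakEL` ((i) exact pairing ∧ (ii) ⊥ coarse pure gauges ∧ (iii) `|Λ Z| ≤ 2ε₀(L^{K−n})⁻¹·Σ_c‖Z c‖`);
  ★ `exists_multiplier_field_weakEL` (the Riesz field `λ` with (i)–(iii) and (iv) `‖λ(c)‖ ≤ 2ε₀(L^{K−n})⁻¹`).
* §3 `exists_multiplier_field_of_fibreEL` (the EX knit's `hEL` VERBATIM, via `weakEL_of_fibreEL`; the `IsCritR2` instance is ✓p635612 itself, or §2 through
  `weakEL_of_isCritR2`).

HONEST SCOPE.  Bookkeeping over landed theorems (FILE 1 §1–§2 functional analysis, FILE 2a analysis); constant `2ε₀L^{−(K−n)}` = w1's; nothing of print asserted.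

References: T. Bałaban, CMP 102 (1985) 277–309 [Balaban1985Variational] ((2), (6) p.278, (45)–(48) pp.285–287, (141)–(143) p.299); CMP 99 (1985) 389–434
[Balaban1985BackgroundPropagators] ((3.9)–(3.11) p.392); CMP 98 (1985) 17–51 [Balaban1985Averaging] ((11) p.19).
-/

set_option autoImplicit false

noncomputable section

open scoped BigOperators Matrix.Norms.L2Operator Matrix Topology

namespace Summit.QuantumFields.YangMills.Theorems.Prop7FirstVariationMultiplierBoundWeakEL

open Filter NormedSpace
open Literature.MathematicalPhysics.QuantumFieldTheory.Balaban1983to89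
open Literature.MathematicalPhysics.QuantumFieldTheory.Balaban1983to89.T3ContinuumYM3Torus
open T4Continuum BlockAveraging AveragingRT ExpMeanLog BlockAveragingEMLLinearised BlockAveragingEMLLinearisedBackground BlockAveragingEMLProp2
open T3UnitLawDensityEML T3ConstrainedMinimiser T3TiltDescent T3DescentFibreTower T3LevelShift
open T3RegularMinimiser T3PrintedRegularMinimiser T3Thm1CarrierNative
open B15DeterminingSets (embIter)
open B10Eq27TorusAxialLog (unitsField toUField)
open B10Eq68TorusRegularity (covDivT)
open Summit.QuantumFields.YangMills.Theorems.Prop7TrueLinIterHasDeriv (hasDerivAt_iter)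
open Summit.QuantumFields.YangMills.Theorems.Prop7FirstVariationExactPairing (tower_loop_rows_of_regPr gaugeDir_mem_su2)
open Summit.QuantumFields.YangMills.Theorems.Prop7FirstVariationMultiplierBound
  (exists_factor_abs_le exists_re_trace_pairing norm_le_of_abs_sum_re_trace_mul_le)
open Summit.QuantumFields.YangMills.Theorems.Prop7FirstVariationWeakEL
  (weakEL_of_fibreEL weakEL_of_isCritR2 abs_lin_le_constraint_velocity_weakEL)
open Summit.QuantumFields.YangMills.Theorems.Prop7HolRatioPerStep (coe_mul_star_self)
open Summit.QuantumFields.YangMills.Theorems.Prop8Criticality (expCurve_mem)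

variable (F : T3Family) {n K : ℕ}

/-! ## §1 The multiplier bound in the `Q`-currency under the weak E–L letter -/

/-- ★★ **`|Lin_{U₀}(A)| ≤ 2ε₀L^{−(K−n)}·Σ_c‖(Q (K−n) A)(c)‖` AT A STATIONARY FIBRE POINT** — for every `U₀ ∈ 𝔅_k(V) ∩ (6)(ε₀)` (`10¹⁰L⁶ε₀ ≤ 1`) satisfying the weak
E–L letter `hELw`, every `𝔰𝔲(2)`-valued bond field `A` and every recursion family `Q` of the true one-step linearisations along `U₀`'s tower: FILE 2a's
`abs_lin_le_constraint_velocity_weakEL` along `Γ₀(s) = e^{sA}U₀`, whose averaged velocity is `(Q (K−n) A)(c)·V_c` by `Prop7TrueLinIterHasDeriv.hasDerivAt_iter` — the twin of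
`Prop7FirstVariationExactPairing.abs_lin_le_sum_norm_trueLinIter` with `IsCritR2` replaced by `hELw`. [cite: Balaban1985Variational, (141)-(143) p.299; Balaban1985BackgroundPropagators, (3.11) p.392] -/
theorem abs_lin_le_sum_norm_trueLinIter_weakEL (hnK : n ≤ K)
    {V : GaugeField (F.P n) 0 (Matrix.specialUnitaryGroup (Fin 2) ℂ)} {U₀ : GaugeField (F.P K) 0 (Matrix.specialUnitaryGroup (Fin 2) ℂ)}
    (hU₀fib : U₀ ∈ fibre F ℰp n K hnK V)
    (hELw : ∀ (γ : ℝ → GaugeField (F.P K) 0 (Matrix.specialUnitaryGroup (Fin 2) ℂ)) (ξ : PBond (F.P K) 0 → Matrix (Fin 2) (Fin 2) ℂ), γ 0 = U₀ →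
      (∀ b : PBond (F.P K) 0, DifferentiableAt ℝ (fun t : ℝ => (γ t b : Matrix (Fin 2) (Fin 2) ℂ)) 0) →
      (∀ᶠ t in 𝓝 (0 : ℝ), γ t ∈ fibre F ℰp n K hnK V) →
      (∀ b : PBond (F.P K) 0, HasDerivAt (fun t : ℝ => (γ t b : Matrix (Fin 2) (Fin 2) ℂ) * star (U₀ b : Matrix (Fin 2) (Fin 2) ℂ)) (ξ b) 0) →
        ∑ p : Plaq (F.P K) 0, (1 / 2) * ((((((GaugeField.plaqHol U₀ p : Matrix.specialUnitaryGroup (Fin 2) ℂ) : Matrix (Fin 2) (Fin 2) ℂ)) - 1)ᴴ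
          * ((ξ ⟨p.src, p.μ⟩
              + (U₀ ⟨p.src, p.μ⟩ : Matrix (Fin 2) (Fin 2) ℂ) * ξ ⟨p.src.shift p.μ, p.ν⟩ * star (U₀ ⟨p.src, p.μ⟩ : Matrix (Fin 2) (Fin 2) ℂ)
              - ((U₀ ⟨p.src, p.μ⟩ * U₀ ⟨p.src.shift p.μ, p.ν⟩ * (U₀ ⟨p.src.shift p.ν, p.μ⟩)⁻¹ : Matrix.specialUnitaryGroup (Fin 2) ℂ) : Matrix (Fin 2) (Fin 2) ℂ)
                  * ξ ⟨p.src.shift p.ν, p.μ⟩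
                  * star ((U₀ ⟨p.src, p.μ⟩ * U₀ ⟨p.src.shift p.μ, p.ν⟩ * (U₀ ⟨p.src.shift p.ν, p.μ⟩)⁻¹ : Matrix.specialUnitaryGroup (Fin 2) ℂ) : Matrix (Fin 2) (Fin 2) ℂ)
              - ((GaugeField.plaqHol U₀ p : Matrix.specialUnitaryGroup (Fin 2) ℂ) : Matrix (Fin 2) (Fin 2) ℂ) * ξ ⟨p.src, p.ν⟩
                  * star ((GaugeField.plaqHol U₀ p : Matrix.specialUnitaryGroup (Fin 2) ℂ) : Matrix (Fin 2) (Fin 2) ℂ))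
            * ((GaugeField.plaqHol U₀ p : Matrix.specialUnitaryGroup (Fin 2) ℂ) : Matrix (Fin 2) (Fin 2) ℂ))).trace).re = 0)
    {ε₀ : ℝ} (hε₀ : 0 < ε₀) (hε : 10 ^ 10 * (F.L : ℝ) ^ 6 * ε₀ ≤ 1) (hU₀reg : RegPr F n K ε₀ U₀)
    (Q : (k : ℕ) → (PBond (F.P K) 0 → Matrix (Fin 2) (Fin 2) ℂ) → PBond (F.P K) k → Matrix (Fin 2) (Fin 2) ℂ) (hQ0 : ∀ Y, Q 0 Y = Y)
    (hQs : ∀ (k : ℕ) (Y : PBond (F.P K) 0 → Matrix (Fin 2) (Fin 2) ℂ) (c : PBond (F.P K) (k + 1)), Q (k + 1) Y c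
      = fderiv ℂ (eml : (Idx (F.P K) → Matrix (Fin 2) (Fin 2) ℂ) → Matrix (Fin 2) (Fin 2) ℂ)
            (fun i => ((loopHol (Averaging.iter (fun i => blockAvg (P := F.P K) (j := i) (expMeanLogSU (n := Fin 2))) k U₀) c i :
              Matrix.specialUnitaryGroup (Fin 2) ℂ) : Matrix (Fin 2) (Fin 2) ℂ))
            (fun i => covWalkSum (Averaging.iter (fun i => blockAvg (P := F.P K) (j := i) (expMeanLogSU (n := Fin 2))) k U₀) (Q k Y)
                (walk (emb c.src) (loopWord (F.P K).L c.dir (off i.1) i.2.1 i.2.2))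
              * ((loopHol (Averaging.iter (fun i => blockAvg (P := F.P K) (j := i) (expMeanLogSU (n := Fin 2))) k U₀) c i :
                Matrix.specialUnitaryGroup (Fin 2) ℂ) : Matrix (Fin 2) (Fin 2) ℂ))
            * star ((corr (expMeanLogSU (n := Fin 2)) (Averaging.iter (fun i => blockAvg (P := F.P K) (j := i) (expMeanLogSU (n := Fin 2))) k U₀) c :
                Matrix.specialUnitaryGroup (Fin 2) ℂ) : Matrix (Fin 2) (Fin 2) ℂ)
          + ((corr (expMeanLogSU (n := Fin 2)) (Averaging.iter (fun i => blockAvg (P := F.P K) (j := i) (expMeanLogSU (n := Fin 2))) k U₀) c :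
                Matrix.specialUnitaryGroup (Fin 2) ℂ) : Matrix (Fin 2) (Fin 2) ℂ)
            * covWalkSum (Averaging.iter (fun i => blockAvg (P := F.P K) (j := i) (expMeanLogSU (n := Fin 2))) k U₀) (Q k Y)
                (walk (emb c.src) (List.replicate (F.P K).L (c.dir, true)))
            * star ((corr (expMeanLogSU (n := Fin 2)) (Averaging.iter (fun i => blockAvg (P := F.P K) (j := i) (expMeanLogSU (n := Fin 2))) k U₀) c :
                Matrix.specialUnitaryGroup (Fin 2) ℂ) : Matrix (Fin 2) (Fin 2) ℂ))
    (A : PBond (F.P K) 0 → Matrix (Fin 2) (Fin 2) ℂ) (hA : ∀ b, A b ∈ skewAdjoint (Matrix (Fin 2) (Fin 2) ℂ)) (htr : ∀ b, (A b).trace = 0) :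
    |∑ p : Plaq (F.P K) 0, (1 / 2) * ((((((GaugeField.plaqHol U₀ p : Matrix.specialUnitaryGroup (Fin 2) ℂ) : Matrix (Fin 2) (Fin 2) ℂ)) - 1)ᴴ
          * ((A ⟨p.src, p.μ⟩
              + (U₀ ⟨p.src, p.μ⟩ : Matrix (Fin 2) (Fin 2) ℂ) * A ⟨p.src.shift p.μ, p.ν⟩ * star (U₀ ⟨p.src, p.μ⟩ : Matrix (Fin 2) (Fin 2) ℂ)
              - ((U₀ ⟨p.src, p.μ⟩ * U₀ ⟨p.src.shift p.μ, p.ν⟩ * (U₀ ⟨p.src.shift p.ν, p.μ⟩)⁻¹ : Matrix.specialUnitaryGroup (Fin 2) ℂ) : Matrix (Fin 2) (Fin 2) ℂ)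
                  * A ⟨p.src.shift p.ν, p.μ⟩
                  * star ((U₀ ⟨p.src, p.μ⟩ * U₀ ⟨p.src.shift p.μ, p.ν⟩ * (U₀ ⟨p.src.shift p.ν, p.μ⟩)⁻¹ : Matrix.specialUnitaryGroup (Fin 2) ℂ) : Matrix (Fin 2) (Fin 2) ℂ)
              - ((GaugeField.plaqHol U₀ p : Matrix.specialUnitaryGroup (Fin 2) ℂ) : Matrix (Fin 2) (Fin 2) ℂ) * A ⟨p.src, p.ν⟩
                  * star ((GaugeField.plaqHol U₀ p : Matrix.specialUnitaryGroup (Fin 2) ℂ) : Matrix (Fin 2) (Fin 2) ℂ))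
            * ((GaugeField.plaqHol U₀ p : Matrix.specialUnitaryGroup (Fin 2) ℂ) : Matrix (Fin 2) (Fin 2) ℂ))).trace).re|
      ≤ 2 * ε₀ * ((F.L : ℝ) ^ (K - n))⁻¹ * ∑ c : PBond (F.P K) (K - n), ‖Q (K - n) A c‖ := by
  classical
  -- the exponential family and its velocities
  set Γ₀ : ℝ → GaugeField (F.P K) 0 (Matrix.specialUnitaryGroup (Fin 2) ℂ) :=
    fun t b => ⟨exp (t • A b) * (U₀ b : Matrix (Fin 2) (Fin 2) ℂ), expCurve_mem (hA b) (htr b) (U₀ b) t⟩ with hΓ₀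
  have hΓ₀0 : Γ₀ 0 = U₀ := by
    funext b; apply Subtype.ext
    show exp ((0 : ℝ) • A b) * (U₀ b : Matrix (Fin 2) (Fin 2) ℂ) = (U₀ b : Matrix (Fin 2) (Fin 2) ℂ)
    rw [zero_smul, exp_zero, one_mul]
  have hΓ₀d : ∀ b : PBond (F.P K) 0, HasDerivAt (fun t : ℝ => (Γ₀ t b : Matrix (Fin 2) (Fin 2) ℂ)) (A b * (U₀ b : Matrix (Fin 2) (Fin 2) ℂ)) 0 := by
    intro b
    have h1 := (hasDerivAt_exp_smul_const' (A b) (0 : ℝ)).mul_const (U₀ b : Matrix (Fin 2) (Fin 2) ℂ)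
    simp only [zero_smul, exp_zero, mul_one] at h1
    exact h1
  have hUU : ∀ b : PBond (F.P K) 0, (U₀ b : Matrix (Fin 2) (Fin 2) ℂ) * star (U₀ b : Matrix (Fin 2) (Fin 2) ℂ) = 1 := fun b => coe_mul_star_self _
  have hratio : ∀ b : PBond (F.P K) 0, HasDerivAt (fun s : ℝ => ((Γ₀ s b : Matrix.specialUnitaryGroup (Fin 2) ℂ) : Matrix (Fin 2) (Fin 2) ℂ) *
      star ((U₀ b : Matrix.specialUnitaryGroup (Fin 2) ℂ) : Matrix (Fin 2) (Fin 2) ℂ)) (A b) 0 := by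
    intro b
    have h := (hΓ₀d b).mul_const (star ((U₀ b : Matrix.specialUnitaryGroup (Fin 2) ℂ) : Matrix (Fin 2) (Fin 2) ℂ))
    rwa [Matrix.mul_assoc, hUU, Matrix.mul_one] at h
  obtain ⟨hα, ha24, haN⟩ := tower_loop_rows_of_regPr F hε₀ hε hU₀reg (K := K) (n := n)
  have hmain := abs_lin_le_constraint_velocity_weakEL F hnK hU₀fib hELw hε₀ hε hU₀reg Γ₀ hΓ₀0 A hΓ₀d
  refine hmain.trans (le_of_eq ?_)
  congr 1
  refine Finset.sum_congr rfl fun c _ => ?_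
  rw [(hasDerivAt_iter U₀ Γ₀ hΓ₀0 A hratio Q hQ0 hQs _ hα ha24 haN c).deriv]
  exact CStarRing.norm_mul_mem_unitary _ (Matrix.specialUnitaryGroup_le_unitaryGroup (Averaging.iter _ (K - n) U₀ c).2)

/-! ## §2 The bounded multiplier and its Riesz field under the weak E–L letter -/

/-- ★★ **THE BOUNDED MULTIPLIER THEOREM AT A STATIONARY FIBRE POINT.**  For `U₀ ∈ 𝔅_k(V) ∩ (6)(ε₀)` (`10¹⁰L⁶ε₀ ≤ 1`) satisfying the weak E–L letter `hELw` and every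
recursion family `Q`: a real-linear `Λ` on the level-`(K−n)` bond fields with (i) `Lin_{U₀}(A) = Λ (Q (K−n) A)` for every `𝔰𝔲(2)`-valued `A`, (ii) `Λ` kills every coarse
pure gauge `c ↦ ξ(embIter c₋) − V_cξ(embIter c₊)V_c*`, (iii) `|Λ Z| ≤ 2ε₀(L^{K−n})⁻¹·Σ_c‖Z c‖` for every `Z` — ✓p635612's `exists_multiplier_functional_bounded` with
`IsCritR2` replaced by `hELw` (§1 + FILE 1's `exists_factor_abs_le`; (ii) by `trueLinIter_pureGauge` + `lin_gaugeDir_eq_zero`).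
[cite: Balaban1985Variational, (141)-(143) p.299, (45)-(48) pp.285-287; Balaban1985BackgroundPropagators, (3.9)-(3.11) p.392; Balaban1985Averaging, (11) p.19] -/
theorem exists_multiplier_functional_bounded_weakEL (hnK : n ≤ K)
    {V : GaugeField (F.P n) 0 (Matrix.specialUnitaryGroup (Fin 2) ℂ)} {U₀ : GaugeField (F.P K) 0 (Matrix.specialUnitaryGroup (Fin 2) ℂ)}
    (hU₀fib : U₀ ∈ fibre F ℰp n K hnK V)
    (hELw : ∀ (γ : ℝ → GaugeField (F.P K) 0 (Matrix.specialUnitaryGroup (Fin 2) ℂ)) (ξ : PBond (F.P K) 0 → Matrix (Fin 2) (Fin 2) ℂ), γ 0 = U₀ →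
      (∀ b : PBond (F.P K) 0, DifferentiableAt ℝ (fun t : ℝ => (γ t b : Matrix (Fin 2) (Fin 2) ℂ)) 0) →
      (∀ᶠ t in 𝓝 (0 : ℝ), γ t ∈ fibre F ℰp n K hnK V) →
      (∀ b : PBond (F.P K) 0, HasDerivAt (fun t : ℝ => (γ t b : Matrix (Fin 2) (Fin 2) ℂ) * star (U₀ b : Matrix (Fin 2) (Fin 2) ℂ)) (ξ b) 0) →
        ∑ p : Plaq (F.P K) 0, (1 / 2) * ((((((GaugeField.plaqHol U₀ p : Matrix.specialUnitaryGroup (Fin 2) ℂ) : Matrix (Fin 2) (Fin 2) ℂ)) - 1)ᴴ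
          * ((ξ ⟨p.src, p.μ⟩
              + (U₀ ⟨p.src, p.μ⟩ : Matrix (Fin 2) (Fin 2) ℂ) * ξ ⟨p.src.shift p.μ, p.ν⟩ * star (U₀ ⟨p.src, p.μ⟩ : Matrix (Fin 2) (Fin 2) ℂ)
              - ((U₀ ⟨p.src, p.μ⟩ * U₀ ⟨p.src.shift p.μ, p.ν⟩ * (U₀ ⟨p.src.shift p.ν, p.μ⟩)⁻¹ : Matrix.specialUnitaryGroup (Fin 2) ℂ) : Matrix (Fin 2) (Fin 2) ℂ)
                  * ξ ⟨p.src.shift p.ν, p.μ⟩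
                  * star ((U₀ ⟨p.src, p.μ⟩ * U₀ ⟨p.src.shift p.μ, p.ν⟩ * (U₀ ⟨p.src.shift p.ν, p.μ⟩)⁻¹ : Matrix.specialUnitaryGroup (Fin 2) ℂ) : Matrix (Fin 2) (Fin 2) ℂ)
              - ((GaugeField.plaqHol U₀ p : Matrix.specialUnitaryGroup (Fin 2) ℂ) : Matrix (Fin 2) (Fin 2) ℂ) * ξ ⟨p.src, p.ν⟩
                  * star ((GaugeField.plaqHol U₀ p : Matrix.specialUnitaryGroup (Fin 2) ℂ) : Matrix (Fin 2) (Fin 2) ℂ))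
            * ((GaugeField.plaqHol U₀ p : Matrix.specialUnitaryGroup (Fin 2) ℂ) : Matrix (Fin 2) (Fin 2) ℂ))).trace).re = 0)
    {ε₀ : ℝ} (hε₀ : 0 < ε₀) (hε : 10 ^ 10 * (F.L : ℝ) ^ 6 * ε₀ ≤ 1) (hU₀reg : RegPr F n K ε₀ U₀)
    (Q : (k : ℕ) → (PBond (F.P K) 0 → Matrix (Fin 2) (Fin 2) ℂ) → PBond (F.P K) k → Matrix (Fin 2) (Fin 2) ℂ) (hQ0 : ∀ Y, Q 0 Y = Y)
    (hQs : ∀ (k : ℕ) (Y : PBond (F.P K) 0 → Matrix (Fin 2) (Fin 2) ℂ) (c : PBond (F.P K) (k + 1)), Q (k + 1) Y c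
      = fderiv ℂ (eml : (Idx (F.P K) → Matrix (Fin 2) (Fin 2) ℂ) → Matrix (Fin 2) (Fin 2) ℂ)
            (fun i => ((loopHol (Averaging.iter (fun i => blockAvg (P := F.P K) (j := i) (expMeanLogSU (n := Fin 2))) k U₀) c i :
              Matrix.specialUnitaryGroup (Fin 2) ℂ) : Matrix (Fin 2) (Fin 2) ℂ))
            (fun i => covWalkSum (Averaging.iter (fun i => blockAvg (P := F.P K) (j := i) (expMeanLogSU (n := Fin 2))) k U₀) (Q k Y)
                (walk (emb c.src) (loopWord (F.P K).L c.dir (off i.1) i.2.1 i.2.2))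
              * ((loopHol (Averaging.iter (fun i => blockAvg (P := F.P K) (j := i) (expMeanLogSU (n := Fin 2))) k U₀) c i :
                Matrix.specialUnitaryGroup (Fin 2) ℂ) : Matrix (Fin 2) (Fin 2) ℂ))
            * star ((corr (expMeanLogSU (n := Fin 2)) (Averaging.iter (fun i => blockAvg (P := F.P K) (j := i) (expMeanLogSU (n := Fin 2))) k U₀) c :
                Matrix.specialUnitaryGroup (Fin 2) ℂ) : Matrix (Fin 2) (Fin 2) ℂ)
          + ((corr (expMeanLogSU (n := Fin 2)) (Averaging.iter (fun i => blockAvg (P := F.P K) (j := i) (expMeanLogSU (n := Fin 2))) k U₀) c :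
                Matrix.specialUnitaryGroup (Fin 2) ℂ) : Matrix (Fin 2) (Fin 2) ℂ)
            * covWalkSum (Averaging.iter (fun i => blockAvg (P := F.P K) (j := i) (expMeanLogSU (n := Fin 2))) k U₀) (Q k Y)
                (walk (emb c.src) (List.replicate (F.P K).L (c.dir, true)))
            * star ((corr (expMeanLogSU (n := Fin 2)) (Averaging.iter (fun i => blockAvg (P := F.P K) (j := i) (expMeanLogSU (n := Fin 2))) k U₀) c :
                Matrix.specialUnitaryGroup (Fin 2) ℂ) : Matrix (Fin 2) (Fin 2) ℂ)) :
    ∃ Λ : (PBond (F.P K) (K - n) → Matrix (Fin 2) (Fin 2) ℂ) →ₗ[ℝ] ℝ,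
      (∀ A : PBond (F.P K) 0 → Matrix (Fin 2) (Fin 2) ℂ, (∀ b, A b ∈ skewAdjoint (Matrix (Fin 2) (Fin 2) ℂ)) → (∀ b, (A b).trace = 0) →
        ∑ p : Plaq (F.P K) 0, (1 / 2) * ((((((GaugeField.plaqHol U₀ p : Matrix.specialUnitaryGroup (Fin 2) ℂ) : Matrix (Fin 2) (Fin 2) ℂ)) - 1)ᴴ
          * ((A ⟨p.src, p.μ⟩
              + (U₀ ⟨p.src, p.μ⟩ : Matrix (Fin 2) (Fin 2) ℂ) * A ⟨p.src.shift p.μ, p.ν⟩ * star (U₀ ⟨p.src, p.μ⟩ : Matrix (Fin 2) (Fin 2) ℂ)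
              - ((U₀ ⟨p.src, p.μ⟩ * U₀ ⟨p.src.shift p.μ, p.ν⟩ * (U₀ ⟨p.src.shift p.ν, p.μ⟩)⁻¹ : Matrix.specialUnitaryGroup (Fin 2) ℂ) : Matrix (Fin 2) (Fin 2) ℂ)
                  * A ⟨p.src.shift p.ν, p.μ⟩
                  * star ((U₀ ⟨p.src, p.μ⟩ * U₀ ⟨p.src.shift p.μ, p.ν⟩ * (U₀ ⟨p.src.shift p.ν, p.μ⟩)⁻¹ : Matrix.specialUnitaryGroup (Fin 2) ℂ) : Matrix (Fin 2) (Fin 2) ℂ)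
              - ((GaugeField.plaqHol U₀ p : Matrix.specialUnitaryGroup (Fin 2) ℂ) : Matrix (Fin 2) (Fin 2) ℂ) * A ⟨p.src, p.ν⟩
                  * star ((GaugeField.plaqHol U₀ p : Matrix.specialUnitaryGroup (Fin 2) ℂ) : Matrix (Fin 2) (Fin 2) ℂ))
            * ((GaugeField.plaqHol U₀ p : Matrix.specialUnitaryGroup (Fin 2) ℂ) : Matrix (Fin 2) (Fin 2) ℂ))).trace).re = Λ (Q (K - n) A)) ∧
      (∀ ξ : Site (F.P K) 0 → Matrix (Fin 2) (Fin 2) ℂ, (∀ x, ξ x ∈ skewAdjoint (Matrix (Fin 2) (Fin 2) ℂ)) → (∀ x, (ξ x).trace = 0) →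
        Λ (fun c : PBond (F.P K) (K - n) => ξ (embIter (K - n) c.src)
          - ((Averaging.iter (fun i => blockAvg (P := F.P K) (j := i) (expMeanLogSU (n := Fin 2))) (K - n) U₀ c : Matrix.specialUnitaryGroup (Fin 2) ℂ) :
              Matrix (Fin 2) (Fin 2) ℂ) * ξ (embIter (K - n) c.tgt)
            * star ((Averaging.iter (fun i => blockAvg (P := F.P K) (j := i) (expMeanLogSU (n := Fin 2))) (K - n) U₀ c : Matrix.specialUnitaryGroup (Fin 2) ℂ) :
              Matrix (Fin 2) (Fin 2) ℂ)) = 0) ∧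
      (∀ Z : PBond (F.P K) (K - n) → Matrix (Fin 2) (Fin 2) ℂ, |Λ Z| ≤ 2 * ε₀ * ((F.L : ℝ) ^ (K - n))⁻¹ * ∑ c, ‖Z c‖) := by
  classical
  -- the real subspace of `𝔰𝔲(2)`-valued bond fields
  let S : Submodule ℝ (PBond (F.P K) 0 → Matrix (Fin 2) (Fin 2) ℂ) :=
    { carrier := {A | ∀ b, A b ∈ skewAdjoint (Matrix (Fin 2) (Fin 2) ℂ) ∧ (A b).trace = 0}
      add_mem' := fun {A B} hA hB b => ⟨by rw [Pi.add_apply]; exact (skewAdjoint _).add_mem (hA b).1 (hB b).1,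
        by rw [Pi.add_apply, Matrix.trace_add, (hA b).2, (hB b).2, add_zero]⟩
      zero_mem' := fun b => ⟨by rw [Pi.zero_apply]; exact (skewAdjoint _).zero_mem, by rw [Pi.zero_apply, Matrix.trace_zero]⟩
      smul_mem' := fun r A hA b => ⟨by rw [Pi.smul_apply]; exact skewAdjoint.smul_mem r (hA b).1,
        by rw [Pi.smul_apply, Matrix.trace_smul, (hA b).2, smul_zero]⟩ }
  -- `Lin_{U₀}` as a real-linear functional on `S` (via the current pairing)
  let L : S →ₗ[ℝ] ℝ :=
    { toFun := fun A => -(1 / 2) * ∑ b : PBond (F.P K) 0, ((A.1 b * covDivT 1 (unitsField (toUField U₀)) b.dir b.src).trace).re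
      map_add' := fun A B => by
        simp only [Submodule.coe_add, Pi.add_apply, Matrix.add_mul, Matrix.trace_add, Complex.add_re, Finset.sum_add_distrib]
        ring
      map_smul' := fun r A => by
        simp only [Submodule.coe_smul, Pi.smul_apply, Matrix.smul_mul, Matrix.trace_smul, Complex.smul_re, ← Finset.mul_sum,
          RingHom.id_apply, smul_eq_mul]
        ring }
  -- `Q (K−n)` as a real-linear map on `S`
  let T : S →ₗ[ℝ] (PBond (F.P K) (K - n) → Matrix (Fin 2) (Fin 2) ℂ) :=
    { toFun := fun A => Q (K - n) A.1
      map_add' := fun A B => by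
        funext c
        rw [Submodule.coe_add, Pi.add_apply]
        exact Prop7TrueLinPureGaugeIter.trueLinIter_add U₀ Q hQ0 hQs (K - n) A.1 B.1 c
      map_smul' := fun r A => by
        funext c
        have e1 : ((r • A : S) : PBond (F.P K) 0 → Matrix (Fin 2) (Fin 2) ℂ) = (r : ℂ) • (A.1 : PBond (F.P K) 0 → Matrix (Fin 2) (Fin 2) ℂ) := by
          rw [Submodule.coe_smul]; exact RCLike.real_smul_eq_coe_smul (K := ℂ) r _
        rw [e1, RingHom.id_apply, Pi.smul_apply, Prop7TrueLinPureGaugeIter.trueLinIter_smul U₀ Q hQ0 hQs (K - n) (r : ℂ) A.1 c]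
        exact (RCLike.real_smul_eq_coe_smul (K := ℂ) r _).symm }
  -- the sublinear majorant `N Z = 2ε₀(L^{K−n})⁻¹·Σ_c‖Z c‖`
  let N : (PBond (F.P K) (K - n) → Matrix (Fin 2) (Fin 2) ℂ) → ℝ := fun Z => 2 * ε₀ * ((F.L : ℝ) ^ (K - n))⁻¹ * ∑ c, ‖Z c‖
  have hC0 : 0 ≤ 2 * ε₀ * ((F.L : ℝ) ^ (K - n))⁻¹ := by positivity
  have N_hom : ∀ c : ℝ, 0 < c → ∀ x, N (c • x) = c * N x := by
    intro c hc x
    show 2 * ε₀ * ((F.L : ℝ) ^ (K - n))⁻¹ * ∑ c', ‖(c • x) c'‖ = c * (2 * ε₀ * ((F.L : ℝ) ^ (K - n))⁻¹ * ∑ c', ‖x c'‖)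
    simp only [Pi.smul_apply, norm_smul, Real.norm_eq_abs, abs_of_pos hc, ← Finset.mul_sum]
    ring
  have N_add : ∀ x y, N (x + y) ≤ N x + N y := by
    intro x y
    show 2 * ε₀ * ((F.L : ℝ) ^ (K - n))⁻¹ * ∑ c, ‖(x + y) c‖
      ≤ 2 * ε₀ * ((F.L : ℝ) ^ (K - n))⁻¹ * ∑ c, ‖x c‖ + 2 * ε₀ * ((F.L : ℝ) ^ (K - n))⁻¹ * ∑ c, ‖y c‖
    rw [← mul_add, ← Finset.sum_add_distrib]
    exact mul_le_mul_of_nonneg_left (Finset.sum_le_sum fun c _ => by rw [Pi.add_apply]; exact norm_add_le _ _) hC0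
  have N_neg : ∀ x, N (-x) = N x := by
    intro x
    show 2 * ε₀ * ((F.L : ℝ) ^ (K - n))⁻¹ * ∑ c, ‖(-x) c‖ = 2 * ε₀ * ((F.L : ℝ) ^ (K - n))⁻¹ * ∑ c, ‖x c‖
    simp only [Pi.neg_apply, norm_neg]
  -- domination `|L A| ≤ N (T A)` by §1 of the exact-pairing file
  have hdom : ∀ A : S, |L A| ≤ N (T A) := by
    intro A
    have h1 := abs_lin_le_sum_norm_trueLinIter_weakEL F hnK hU₀fib hELw hε₀ hε hU₀reg Q hQ0 hQs A.1 (fun b => (A.2 b).1) (fun b => (A.2 b).2)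
    rw [Prop7FirstVariationCurrent.lin_eq_neg_half_sum_re_trace_mul_covDivT] at h1
    exact h1
  obtain ⟨Λ, hΛ, hΛN⟩ := exists_factor_abs_le L T N N_hom N_add N_neg hdom
  refine ⟨Λ, fun A hA htr => ?_, fun ξ hξ hξt => ?_, fun Z => hΛN Z⟩
  · have h := hΛ ⟨A, fun b => ⟨hA b, htr b⟩⟩
    rw [Prop7FirstVariationCurrent.lin_eq_neg_half_sum_re_trace_mul_covDivT]
    exact h
  · obtain ⟨hα, _, haN⟩ := tower_loop_rows_of_regPr F hε₀ hε hU₀reg (K := K) (n := n)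
    -- the fine gauge direction of `ξ` is in `S`
    let Aξ : S := ⟨fun b : PBond (F.P K) 0 => ξ b.src - ((U₀ b : Matrix.specialUnitaryGroup (Fin 2) ℂ) : Matrix (Fin 2) (Fin 2) ℂ) * ξ b.tgt *
        star ((U₀ b : Matrix.specialUnitaryGroup (Fin 2) ℂ) : Matrix (Fin 2) (Fin 2) ℂ),
      fun b => gaugeDir_mem_su2 (hξ b.src) (hξt b.src) (hξ b.tgt) (hξt b.tgt) (U₀ b)⟩
    have hQξ := Prop7TrueLinPureGaugeIter.trueLinIter_pureGauge U₀ Q hQ0 hQs ξ (K - n)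
      (fun j hj c i => (hα j hj c i).trans_lt (haN j hj))
    have hT : T Aξ = fun c : PBond (F.P K) (K - n) => ξ (embIter (K - n) c.src)
          - ((Averaging.iter (fun i => blockAvg (P := F.P K) (j := i) (expMeanLogSU (n := Fin 2))) (K - n) U₀ c : Matrix.specialUnitaryGroup (Fin 2) ℂ) :
              Matrix (Fin 2) (Fin 2) ℂ) * ξ (embIter (K - n) c.tgt)
            * star ((Averaging.iter (fun i => blockAvg (P := F.P K) (j := i) (expMeanLogSU (n := Fin 2))) (K - n) U₀ c : Matrix.specialUnitaryGroup (Fin 2) ℂ) :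
              Matrix (Fin 2) (Fin 2) ℂ) := funext fun c => hQξ c
    have hL : L Aξ = 0 := by
      show -(1 / 2) * ∑ b : PBond (F.P K) 0, (((fun b : PBond (F.P K) 0 => ξ b.src - ((U₀ b : Matrix.specialUnitaryGroup (Fin 2) ℂ) : Matrix (Fin 2) (Fin 2) ℂ) * ξ b.tgt *
        star ((U₀ b : Matrix.specialUnitaryGroup (Fin 2) ℂ) : Matrix (Fin 2) (Fin 2) ℂ)) b * covDivT 1 (unitsField (toUField U₀)) b.dir b.src).trace).re = 0
      rw [← Prop7FirstVariationCurrent.lin_eq_neg_half_sum_re_trace_mul_covDivT]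
      exact Prop7LinGaugeInvariance.lin_gaugeDir_eq_zero U₀ ξ
    rw [← hT, ← hΛ Aξ, hL]

/-- ★ **THE MULTIPLIER FIELD (RIESZ REPRESENTATIVE) WITH ITS POINTWISE SIZE, UNDER THE WEAK E–L LETTER.**  Same binders: there is a coarse bond field `λ : T^{(K−n)}-bonds → M₂(ℂ)` — the Lagrange
multiplier of the (0.4)-constraint read through the trace pairing `⟨λ, Z⟩ = Σ_c Re tr(λ(c)Z(c))` — with (i) `Lin_{U₀}(A) = Σ_c Re tr(λ(c)·(Q (K−n) A)(c))` for every
`𝔰𝔲(2)`-valued `A`, (ii) `Σ_c Re tr(λ(c)·(ξ(c₋) − V_cξ(c₊)V_c*)) = 0` for every `𝔰𝔲(2)`-valued site field `ξ` (the multiplier field is orthogonal to every coarse pure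
gauge — its `𝔰𝔲(2)`-covariant divergence at `V` vanishes, weakly), (iii) `|Σ_c Re tr(λ(c)Z(c))| ≤ 2ε₀(L^{K−n})⁻¹·Σ_c‖Z c‖` for every `Z`, and (iv) the POINTWISE size
`‖λ(c)‖ ≤ 2ε₀(L^{K−n})⁻¹` at every coarse bond (§2). [cite: Balaban1985Variational, (141)-(143) p.299, (45)-(48) pp.285-287; Balaban1985BackgroundPropagators, (3.9)-(3.11) p.392] -/
theorem exists_multiplier_field_weakEL (hnK : n ≤ K)
    {V : GaugeField (F.P n) 0 (Matrix.specialUnitaryGroup (Fin 2) ℂ)} {U₀ : GaugeField (F.P K) 0 (Matrix.specialUnitaryGroup (Fin 2) ℂ)}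
    (hU₀fib : U₀ ∈ fibre F ℰp n K hnK V)
    (hELw : ∀ (γ : ℝ → GaugeField (F.P K) 0 (Matrix.specialUnitaryGroup (Fin 2) ℂ)) (ξ : PBond (F.P K) 0 → Matrix (Fin 2) (Fin 2) ℂ), γ 0 = U₀ →
      (∀ b : PBond (F.P K) 0, DifferentiableAt ℝ (fun t : ℝ => (γ t b : Matrix (Fin 2) (Fin 2) ℂ)) 0) →
      (∀ᶠ t in 𝓝 (0 : ℝ), γ t ∈ fibre F ℰp n K hnK V) →
      (∀ b : PBond (F.P K) 0, HasDerivAt (fun t : ℝ => (γ t b : Matrix (Fin 2) (Fin 2) ℂ) * star (U₀ b : Matrix (Fin 2) (Fin 2) ℂ)) (ξ b) 0) →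
        ∑ p : Plaq (F.P K) 0, (1 / 2) * ((((((GaugeField.plaqHol U₀ p : Matrix.specialUnitaryGroup (Fin 2) ℂ) : Matrix (Fin 2) (Fin 2) ℂ)) - 1)ᴴ
          * ((ξ ⟨p.src, p.μ⟩
              + (U₀ ⟨p.src, p.μ⟩ : Matrix (Fin 2) (Fin 2) ℂ) * ξ ⟨p.src.shift p.μ, p.ν⟩ * star (U₀ ⟨p.src, p.μ⟩ : Matrix (Fin 2) (Fin 2) ℂ)
              - ((U₀ ⟨p.src, p.μ⟩ * U₀ ⟨p.src.shift p.μ, p.ν⟩ * (U₀ ⟨p.src.shift p.ν, p.μ⟩)⁻¹ : Matrix.specialUnitaryGroup (Fin 2) ℂ) : Matrix (Fin 2) (Fin 2) ℂ)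
                  * ξ ⟨p.src.shift p.ν, p.μ⟩
                  * star ((U₀ ⟨p.src, p.μ⟩ * U₀ ⟨p.src.shift p.μ, p.ν⟩ * (U₀ ⟨p.src.shift p.ν, p.μ⟩)⁻¹ : Matrix.specialUnitaryGroup (Fin 2) ℂ) : Matrix (Fin 2) (Fin 2) ℂ)
              - ((GaugeField.plaqHol U₀ p : Matrix.specialUnitaryGroup (Fin 2) ℂ) : Matrix (Fin 2) (Fin 2) ℂ) * ξ ⟨p.src, p.ν⟩
                  * star ((GaugeField.plaqHol U₀ p : Matrix.specialUnitaryGroup (Fin 2) ℂ) : Matrix (Fin 2) (Fin 2) ℂ))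
            * ((GaugeField.plaqHol U₀ p : Matrix.specialUnitaryGroup (Fin 2) ℂ) : Matrix (Fin 2) (Fin 2) ℂ))).trace).re = 0)
    {ε₀ : ℝ} (hε₀ : 0 < ε₀) (hε : 10 ^ 10 * (F.L : ℝ) ^ 6 * ε₀ ≤ 1) (hU₀reg : RegPr F n K ε₀ U₀)
    (Q : (k : ℕ) → (PBond (F.P K) 0 → Matrix (Fin 2) (Fin 2) ℂ) → PBond (F.P K) k → Matrix (Fin 2) (Fin 2) ℂ) (hQ0 : ∀ Y, Q 0 Y = Y)
    (hQs : ∀ (k : ℕ) (Y : PBond (F.P K) 0 → Matrix (Fin 2) (Fin 2) ℂ) (c : PBond (F.P K) (k + 1)), Q (k + 1) Y c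
      = fderiv ℂ (eml : (Idx (F.P K) → Matrix (Fin 2) (Fin 2) ℂ) → Matrix (Fin 2) (Fin 2) ℂ)
            (fun i => ((loopHol (Averaging.iter (fun i => blockAvg (P := F.P K) (j := i) (expMeanLogSU (n := Fin 2))) k U₀) c i :
              Matrix.specialUnitaryGroup (Fin 2) ℂ) : Matrix (Fin 2) (Fin 2) ℂ))
            (fun i => covWalkSum (Averaging.iter (fun i => blockAvg (P := F.P K) (j := i) (expMeanLogSU (n := Fin 2))) k U₀) (Q k Y)
                (walk (emb c.src) (loopWord (F.P K).L c.dir (off i.1) i.2.1 i.2.2))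
              * ((loopHol (Averaging.iter (fun i => blockAvg (P := F.P K) (j := i) (expMeanLogSU (n := Fin 2))) k U₀) c i :
                Matrix.specialUnitaryGroup (Fin 2) ℂ) : Matrix (Fin 2) (Fin 2) ℂ))
            * star ((corr (expMeanLogSU (n := Fin 2)) (Averaging.iter (fun i => blockAvg (P := F.P K) (j := i) (expMeanLogSU (n := Fin 2))) k U₀) c :
                Matrix.specialUnitaryGroup (Fin 2) ℂ) : Matrix (Fin 2) (Fin 2) ℂ)
          + ((corr (expMeanLogSU (n := Fin 2)) (Averaging.iter (fun i => blockAvg (P := F.P K) (j := i) (expMeanLogSU (n := Fin 2))) k U₀) c :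
                Matrix.specialUnitaryGroup (Fin 2) ℂ) : Matrix (Fin 2) (Fin 2) ℂ)
            * covWalkSum (Averaging.iter (fun i => blockAvg (P := F.P K) (j := i) (expMeanLogSU (n := Fin 2))) k U₀) (Q k Y)
                (walk (emb c.src) (List.replicate (F.P K).L (c.dir, true)))
            * star ((corr (expMeanLogSU (n := Fin 2)) (Averaging.iter (fun i => blockAvg (P := F.P K) (j := i) (expMeanLogSU (n := Fin 2))) k U₀) c :
                Matrix.specialUnitaryGroup (Fin 2) ℂ) : Matrix (Fin 2) (Fin 2) ℂ)) :
    ∃ lam : PBond (F.P K) (K - n) → Matrix (Fin 2) (Fin 2) ℂ,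
      (∀ A : PBond (F.P K) 0 → Matrix (Fin 2) (Fin 2) ℂ, (∀ b, A b ∈ skewAdjoint (Matrix (Fin 2) (Fin 2) ℂ)) → (∀ b, (A b).trace = 0) →
        ∑ p : Plaq (F.P K) 0, (1 / 2) * ((((((GaugeField.plaqHol U₀ p : Matrix.specialUnitaryGroup (Fin 2) ℂ) : Matrix (Fin 2) (Fin 2) ℂ)) - 1)ᴴ
          * ((A ⟨p.src, p.μ⟩
              + (U₀ ⟨p.src, p.μ⟩ : Matrix (Fin 2) (Fin 2) ℂ) * A ⟨p.src.shift p.μ, p.ν⟩ * star (U₀ ⟨p.src, p.μ⟩ : Matrix (Fin 2) (Fin 2) ℂ)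
              - ((U₀ ⟨p.src, p.μ⟩ * U₀ ⟨p.src.shift p.μ, p.ν⟩ * (U₀ ⟨p.src.shift p.ν, p.μ⟩)⁻¹ : Matrix.specialUnitaryGroup (Fin 2) ℂ) : Matrix (Fin 2) (Fin 2) ℂ)
                  * A ⟨p.src.shift p.ν, p.μ⟩
                  * star ((U₀ ⟨p.src, p.μ⟩ * U₀ ⟨p.src.shift p.μ, p.ν⟩ * (U₀ ⟨p.src.shift p.ν, p.μ⟩)⁻¹ : Matrix.specialUnitaryGroup (Fin 2) ℂ) : Matrix (Fin 2) (Fin 2) ℂ)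
              - ((GaugeField.plaqHol U₀ p : Matrix.specialUnitaryGroup (Fin 2) ℂ) : Matrix (Fin 2) (Fin 2) ℂ) * A ⟨p.src, p.ν⟩
                  * star ((GaugeField.plaqHol U₀ p : Matrix.specialUnitaryGroup (Fin 2) ℂ) : Matrix (Fin 2) (Fin 2) ℂ))
            * ((GaugeField.plaqHol U₀ p : Matrix.specialUnitaryGroup (Fin 2) ℂ) : Matrix (Fin 2) (Fin 2) ℂ))).trace).re = ∑ c, ((lam c * Q (K - n) A c).trace).re) ∧
      (∀ ξ : Site (F.P K) 0 → Matrix (Fin 2) (Fin 2) ℂ, (∀ x, ξ x ∈ skewAdjoint (Matrix (Fin 2) (Fin 2) ℂ)) → (∀ x, (ξ x).trace = 0) →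
        ∑ c : PBond (F.P K) (K - n), ((lam c * (ξ (embIter (K - n) c.src)
          - ((Averaging.iter (fun i => blockAvg (P := F.P K) (j := i) (expMeanLogSU (n := Fin 2))) (K - n) U₀ c : Matrix.specialUnitaryGroup (Fin 2) ℂ) :
              Matrix (Fin 2) (Fin 2) ℂ) * ξ (embIter (K - n) c.tgt)
            * star ((Averaging.iter (fun i => blockAvg (P := F.P K) (j := i) (expMeanLogSU (n := Fin 2))) (K - n) U₀ c : Matrix.specialUnitaryGroup (Fin 2) ℂ) :
              Matrix (Fin 2) (Fin 2) ℂ))).trace).re = 0) ∧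
      (∀ Z : PBond (F.P K) (K - n) → Matrix (Fin 2) (Fin 2) ℂ, |∑ c, ((lam c * Z c).trace).re| ≤ 2 * ε₀ * ((F.L : ℝ) ^ (K - n))⁻¹ * ∑ c, ‖Z c‖) ∧
      (∀ c : PBond (F.P K) (K - n), ‖lam c‖ ≤ 2 * ε₀ * ((F.L : ℝ) ^ (K - n))⁻¹) := by
  obtain ⟨Λ, h1, h2, h3⟩ := exists_multiplier_functional_bounded_weakEL F hnK hU₀fib hELw hε₀ hε hU₀reg Q hQ0 hQs
  obtain ⟨lam, hlam⟩ := exists_re_trace_pairing Λ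
  have h3' : ∀ Z : PBond (F.P K) (K - n) → Matrix (Fin 2) (Fin 2) ℂ, |∑ c, ((lam c * Z c).trace).re| ≤ 2 * ε₀ * ((F.L : ℝ) ^ (K - n))⁻¹ * ∑ c, ‖Z c‖ :=
    fun Z => by rw [← hlam Z]; exact h3 Z
  refine ⟨lam, fun A hA htr => ?_, fun ξ hξ hξt => ?_, h3', fun c => norm_le_of_abs_sum_re_trace_mul_le lam (by positivity) h3' c⟩
  · rw [← hlam]; exact h1 A hA htr
  · rw [← hlam]; exact h2 ξ hξ hξt

/-! ## §3 The instance at the EX knit's E–L clause -/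

/-- **THE MULTIPLIER FIELD AT THE EX KNIT'S STATIONARY `W`.**  With `W ∈ 𝔅_k(V)`, the EX knit's E–L clause `hEL` (VERBATIM as in
`Prop7Growth142T3ChartELStat.lin_eq_zero_of_fibreEL_of_gaugeLift`), `W ∈ (6)(ε₀)`, `10¹⁰L⁶ε₀ ≤ 1`: the multiplier field `λ` with the exact pairing, the Lagrange orthogonality,
the `ℓ¹`-dual size and `‖λ(c)‖ ≤ 2ε₀(L^{K−n})⁻¹` (§2 through `weakEL_of_fibreEL`). [cite: Balaban1985Variational, (141)-(143) p.299, (47)-(48) pp.285-287] -/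
theorem exists_multiplier_field_of_fibreEL (hnK : n ≤ K)
    {V : GaugeField (F.P n) 0 (Matrix.specialUnitaryGroup (Fin 2) ℂ)} {W : GaugeField (F.P K) 0 (Matrix.specialUnitaryGroup (Fin 2) ℂ)}
    (hWfib : W ∈ fibre F ℰp n K hnK V)
    (hEL : ∀ φ : ℝ → GaugeField (F.P K) 0 (Matrix.specialUnitaryGroup (Fin 2) ℂ), φ 0 = W → (∀ t, φ t ∈ fibre F ℰp n K hnK V) →
      (∀ b : PBond (F.P K) 0, DifferentiableAt ℝ (fun t => ((φ t b : Matrix.specialUnitaryGroup (Fin 2) ℂ) : Matrix (Fin 2) (Fin 2) ℂ)) 0) →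
        deriv (fun t => wilsonAction4 (φ t)) 0 = 0)
    {ε₀ : ℝ} (hε₀ : 0 < ε₀) (hε : 10 ^ 10 * (F.L : ℝ) ^ 6 * ε₀ ≤ 1) (hWreg : RegPr F n K ε₀ W)
    (Q : (k : ℕ) → (PBond (F.P K) 0 → Matrix (Fin 2) (Fin 2) ℂ) → PBond (F.P K) k → Matrix (Fin 2) (Fin 2) ℂ) (hQ0 : ∀ Y, Q 0 Y = Y)
    (hQs : ∀ (k : ℕ) (Y : PBond (F.P K) 0 → Matrix (Fin 2) (Fin 2) ℂ) (c : PBond (F.P K) (k + 1)), Q (k + 1) Y c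
      = fderiv ℂ (eml : (Idx (F.P K) → Matrix (Fin 2) (Fin 2) ℂ) → Matrix (Fin 2) (Fin 2) ℂ)
            (fun i => ((loopHol (Averaging.iter (fun i => blockAvg (P := F.P K) (j := i) (expMeanLogSU (n := Fin 2))) k W) c i :
              Matrix.specialUnitaryGroup (Fin 2) ℂ) : Matrix (Fin 2) (Fin 2) ℂ))
            (fun i => covWalkSum (Averaging.iter (fun i => blockAvg (P := F.P K) (j := i) (expMeanLogSU (n := Fin 2))) k W) (Q k Y)
                (walk (emb c.src) (loopWord (F.P K).L c.dir (off i.1) i.2.1 i.2.2))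
              * ((loopHol (Averaging.iter (fun i => blockAvg (P := F.P K) (j := i) (expMeanLogSU (n := Fin 2))) k W) c i :
                Matrix.specialUnitaryGroup (Fin 2) ℂ) : Matrix (Fin 2) (Fin 2) ℂ))
            * star ((corr (expMeanLogSU (n := Fin 2)) (Averaging.iter (fun i => blockAvg (P := F.P K) (j := i) (expMeanLogSU (n := Fin 2))) k W) c :
                Matrix.specialUnitaryGroup (Fin 2) ℂ) : Matrix (Fin 2) (Fin 2) ℂ)
          + ((corr (expMeanLogSU (n := Fin 2)) (Averaging.iter (fun i => blockAvg (P := F.P K) (j := i) (expMeanLogSU (n := Fin 2))) k W) c :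
                Matrix.specialUnitaryGroup (Fin 2) ℂ) : Matrix (Fin 2) (Fin 2) ℂ)
            * covWalkSum (Averaging.iter (fun i => blockAvg (P := F.P K) (j := i) (expMeanLogSU (n := Fin 2))) k W) (Q k Y)
                (walk (emb c.src) (List.replicate (F.P K).L (c.dir, true)))
            * star ((corr (expMeanLogSU (n := Fin 2)) (Averaging.iter (fun i => blockAvg (P := F.P K) (j := i) (expMeanLogSU (n := Fin 2))) k W) c :
                Matrix.specialUnitaryGroup (Fin 2) ℂ) : Matrix (Fin 2) (Fin 2) ℂ)) :
    ∃ lam : PBond (F.P K) (K - n) → Matrix (Fin 2) (Fin 2) ℂ,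
      (∀ A : PBond (F.P K) 0 → Matrix (Fin 2) (Fin 2) ℂ, (∀ b, A b ∈ skewAdjoint (Matrix (Fin 2) (Fin 2) ℂ)) → (∀ b, (A b).trace = 0) →
        ∑ p : Plaq (F.P K) 0, (1 / 2) * ((((((GaugeField.plaqHol W p : Matrix.specialUnitaryGroup (Fin 2) ℂ) : Matrix (Fin 2) (Fin 2) ℂ)) - 1)ᴴ
          * ((A ⟨p.src, p.μ⟩
              + (W ⟨p.src, p.μ⟩ : Matrix (Fin 2) (Fin 2) ℂ) * A ⟨p.src.shift p.μ, p.ν⟩ * star (W ⟨p.src, p.μ⟩ : Matrix (Fin 2) (Fin 2) ℂ)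
              - ((W ⟨p.src, p.μ⟩ * W ⟨p.src.shift p.μ, p.ν⟩ * (W ⟨p.src.shift p.ν, p.μ⟩)⁻¹ : Matrix.specialUnitaryGroup (Fin 2) ℂ) : Matrix (Fin 2) (Fin 2) ℂ)
                  * A ⟨p.src.shift p.ν, p.μ⟩
                  * star ((W ⟨p.src, p.μ⟩ * W ⟨p.src.shift p.μ, p.ν⟩ * (W ⟨p.src.shift p.ν, p.μ⟩)⁻¹ : Matrix.specialUnitaryGroup (Fin 2) ℂ) : Matrix (Fin 2) (Fin 2) ℂ)
              - ((GaugeField.plaqHol W p : Matrix.specialUnitaryGroup (Fin 2) ℂ) : Matrix (Fin 2) (Fin 2) ℂ) * A ⟨p.src, p.ν⟩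
                  * star ((GaugeField.plaqHol W p : Matrix.specialUnitaryGroup (Fin 2) ℂ) : Matrix (Fin 2) (Fin 2) ℂ))
            * ((GaugeField.plaqHol W p : Matrix.specialUnitaryGroup (Fin 2) ℂ) : Matrix (Fin 2) (Fin 2) ℂ))).trace).re = ∑ c, ((lam c * Q (K - n) A c).trace).re) ∧
      (∀ ξ : Site (F.P K) 0 → Matrix (Fin 2) (Fin 2) ℂ, (∀ x, ξ x ∈ skewAdjoint (Matrix (Fin 2) (Fin 2) ℂ)) → (∀ x, (ξ x).trace = 0) →
        ∑ c : PBond (F.P K) (K - n), ((lam c * (ξ (embIter (K - n) c.src)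
          - ((Averaging.iter (fun i => blockAvg (P := F.P K) (j := i) (expMeanLogSU (n := Fin 2))) (K - n) W c : Matrix.specialUnitaryGroup (Fin 2) ℂ) :
              Matrix (Fin 2) (Fin 2) ℂ) * ξ (embIter (K - n) c.tgt)
            * star ((Averaging.iter (fun i => blockAvg (P := F.P K) (j := i) (expMeanLogSU (n := Fin 2))) (K - n) W c : Matrix.specialUnitaryGroup (Fin 2) ℂ) :
              Matrix (Fin 2) (Fin 2) ℂ))).trace).re = 0) ∧
      (∀ Z : PBond (F.P K) (K - n) → Matrix (Fin 2) (Fin 2) ℂ, |∑ c, ((lam c * Z c).trace).re| ≤ 2 * ε₀ * ((F.L : ℝ) ^ (K - n))⁻¹ * ∑ c, ‖Z c‖) ∧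
      (∀ c : PBond (F.P K) (K - n), ‖lam c‖ ≤ 2 * ε₀ * ((F.L : ℝ) ^ (K - n))⁻¹) := by
  exact exists_multiplier_field_weakEL F hnK hWfib (weakEL_of_fibreEL F hnK hEL) hε₀ hε hWreg Q hQ0 hQs

end Summit.QuantumFields.YangMills.Theorems.Prop7FirstVariationMultiplierBoundWeakEL

end
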